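import Literature.AlgebraicGeometry.Morphisms.ProperHigherDirectImagesCoh
import Literature.AlgebraicGeometry.Modules.PushforwardBaseChangeOpenImmersion
import Literature.AlgebraicGeometry.Modules.AffineLocalizingClosure
import HarnessLib

/-!
# Direct images preserve quasi-coherence ∕ coherence over a LOCALLY Noetherian base
# (Hartshorne II Prop. 5.8 (c); EGA III Thm. 3.2.1 in degree `0`; The Stacks Project, Tags 01LC and 02O5)

Layer `Literature/AlgebraicGeometry/Morphisms`, namespace `Literature.AlgebraicGeometry.Morphisms`.

★ `Morphisms/ProperPushforwardCoh.isAffineLocalizing_pushforward` proves that `π_* G` is affine-localizing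
(= quasi-coherent, EGA I 1.4.1) for `G` affine-localizing on a NOETHERIAN source `X'` (`[NoetherianSpace X']`), and
★ `coh_pushforward_of_isProper` carries `[CompactSpace X']` for the same reason.  Over a base that is only LOCALLY
Noetherian this leaves a hypothesis `hN : IsAffineLocalizing (p_* G)` (or a `[CompactSpace S]`) in every consumer
(`Modules/PushforwardBaseChangeCharts{,Top}`, `…RestrictBase`, `…IsoOfFibreVanishingGeneralBase`,
`Modules/PushforwardHasRankOfFibreVanishing`, `Modules/CompleteLinearSystemLocus`, `Morphisms/ContainmentChartFiniteFlat`,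
`…ContainmentLocusClosedOfTwist`, `…ContainmentLocusFiniteFlat`).  This file discharges it:

* `nonempty_restrict_pushforward_iso` — **`(π_* G)|_V ≅ (π|_V)_* (G|_{π⁻¹V})`** for any open `V` of the base
  (★ `Modules/PushforwardBaseChangeOpenImmersion.isIso_pushforwardBaseChangeHom_of_isOpenImmersion` on the cartesian square
  `π⁻¹V = X' ×_X V`, Mathlib `isPullback_morphismRestrict`, read through Mathlib's `restrictFunctorIsoPullback`);
* **`isAffineLocalizing_pushforward_of_quasiCompact`** — for `π : X' ⟶ X` QUASI-COMPACT with `X`, `X'` locally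
  Noetherian and `G` affine-localizing, `π_* G` is affine-localizing ([Hartshorne1977] II Prop. 5.8 (c); [StacksProject,
  Tag 01LC]): quasi-coherence is affine-local on the base (★ `ProperHigherDirectImagesCoh.isAffineLocalizing_of_restrict`,
  [Hartshorne1977] II Prop. 5.4), and over an affine open `V` the restriction `(π_* G)|_V ≅ (π|_V)_* (G|_{π⁻¹V})` is the
  direct image from the NOETHERIAN scheme `π⁻¹V` (quasi-compact open of a locally Noetherian scheme), where ★
  `isAffineLocalizing_pushforward` applies to `G|_{π⁻¹V}` (★ `Modules/RestrictOpenCoh.isAffineLocalizing_restrict`);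
* `isAffineLocalizing_pushforward_of_locallyOfFiniteType`, `…_of_isQuasicoherent`, **`…_of_isFiniteLocallyFree`** — the
  forms met in practice (`π` quasi-compact and locally of finite type, e.g. proper, over a locally Noetherian base; `G`
  quasi-coherent ∕ finite locally free): THE `hN` of the consumers above, by name;
* **`Coh.pushforward_of_isProper`** — **direct images of coherent modules under PROPER morphisms to a locally
  Noetherian scheme are coherent** (EGA III Thm. 3.2.1 ∕ [StacksProject, Tag 02O5] in degree `0`; [GortzWedhorn2023]
  Thm. 23.17), with NO compactness hypothesis: affine-localizing by the above, affine-locally of finite type by ★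
  `isAffineFiniteType_pushforward_of_isProper`.

Everything PROVED; theorems only; 0 named facts; no instance, no notation, no `sorry`.  Mathlib searched (pin v4.32):
`Scheme.Modules.restrictFunctorIsoPullback`, `isPullback_morphismRestrict`, `Scheme.Hom.isCompact_preimage`,
`IsLocallyNoetherian` of an open subscheme (instance), `IsNoetherian` (used); Mathlib's
`SheafOfModules.isQuasicoherent_pushforward` is the inverse-image-type statement (`pushforward` of sheaves of modules
along a continuous functor with `φ_* 𝒪 ≅ 𝒪`), not Hartshorne II 5.8 (c).  Cell hodgecm-mathlib (B-p09 (g15), (O-4)):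
count-neutral capital for the F-6 (VI) chain — discharges no printed citation of HC_CM, which is proved only modulo its
7 printed citations until rung 0 closes.

## References

* R. Hartshorne, *Algebraic Geometry*, GTM 52 (1977), II Prop. 5.4 (p. 113), II Prop. 5.8 (c) (p. 115). [Hartshorne1977]
* The Stacks Project, Tag 01LC (Schemes, Lemma 26.24.1), Tag 02O5 (Cohomology of Schemes, Proposition 30.19.1).
  [StacksProject]
* U. Görtz, T. Wedhorn, *Algebraic Geometry II* (2023), Thm. 23.17 (p. 306). [GortzWedhorn2023]
* A. Grothendieck, J. Dieudonné, EGA III (Publ. Math. IHÉS 11, 1961), Thm. 3.2.1. [EGAIII1]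
-/

noncomputable section

-- `TopCat.Presheaf`/`Scheme.Modules` are not reducible (as in Mathlib's `AlgebraicGeometry/Modules/Sheaf.lean`).
set_option backward.isDefEq.respectTransparency false

open CategoryTheory CategoryTheory.Limits AlgebraicGeometry TopologicalSpace Opposite
open AlgebraicGeometry.Scheme.Modules

universe u

namespace Literature.AlgebraicGeometry.Morphisms

open Literature.AlgebraicGeometry.Modules Literature.AlgebraicGeometry.Motives

section QuasiCompact

variable {X' X : Scheme.{u}} (π : X' ⟶ X)

/-- **`(π_* G)|_V ≅ (π|_V)_* (G|_{π⁻¹V})`** for an open `V` of the base: the base-change morphism of the cartesian square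
`π⁻¹V = X' ×_X V` (Mathlib `isPullback_morphismRestrict`) is an isomorphism because `V ↪ X` is an open immersion (★
`isIso_pushforwardBaseChangeHom_of_isOpenImmersion`), and Mathlib's `restrictFunctorIsoPullback` identifies both pull-backs
with the restrictions. [cite: StacksProject, Tag 02KG] [cite: Hartshorne1977, III Prop. 9.3 (Remark 9.3.1)] -/
theorem nonempty_restrict_pushforward_iso (G : X'.Modules) (V : X.Opens) :
    Nonempty (((pushforward π).obj G).restrict V.ι ≅ (pushforward (π ∣_ V)).obj (G.restrict (π ⁻¹ᵁ V).ι)) := by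
  have H : IsPullback (π ⁻¹ᵁ V).ι (π ∣_ V) π V.ι := (isPullback_morphismRestrict π V).flip
  haveI := isIso_pushforwardBaseChangeHom_of_isOpenImmersion H G
  exact ⟨(restrictFunctorIsoPullback V.ι).app ((pushforward π).obj G) ≪≫ asIso (pushforwardBaseChangeHom H.w G) ≪≫
    (pushforward (π ∣_ V)).mapIso (((restrictFunctorIsoPullback (π ⁻¹ᵁ V).ι).app G).symm)⟩

/-- The preimage `π⁻¹V` of an affine open under a quasi-compact `π : X' ⟶ X` with `X'` locally Noetherian is a Noetherian
scheme (a quasi-compact open subscheme of a locally Noetherian scheme). [cite: Hartshorne1977, II Prop. 5.8 (c) (proof)] -/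
theorem isNoetherian_preimage [IsLocallyNoetherian X'] [QuasiCompact π] {V : X.Opens} (hV : IsAffineOpen V) :
    IsNoetherian (↑(π ⁻¹ᵁ V) : Scheme.{u}) :=
  haveI : CompactSpace (↑(π ⁻¹ᵁ V) : Scheme.{u}) := isCompact_iff_compactSpace.mp (π.isCompact_preimage hV.isCompact)
  ⟨⟩

/-- **`π_* G` is affine-localizing (quasi-coherent) for `π` QUASI-COMPACT between locally Noetherian schemes and `G`
affine-localizing** ([Hartshorne1977] II Prop. 5.8 (c), stated there for `X'` Noetherian or `π` quasi-compact separated;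
[StacksProject, Tag 01LC] for `π` quasi-compact quasi-separated — automatic for `X'` locally Noetherian): quasi-coherence
is affine-local on the base (★ `isAffineLocalizing_of_restrict`, [Hartshorne1977] II Prop. 5.4), and over an affine open
`V` of `X` one has `(π_* G)|_V ≅ (π|_V)_* (G|_{π⁻¹V})` with `π⁻¹V` NOETHERIAN, where ★ `isAffineLocalizing_pushforward`
applies to the affine-localizing `G|_{π⁻¹V}` (★ `isAffineLocalizing_restrict`).
[cite: Hartshorne1977, II Prop. 5.8 (c) (p. 115)] [cite: StacksProject, Tag 01LC] -/
theorem isAffineLocalizing_pushforward_of_quasiCompact [IsLocallyNoetherian X] [IsLocallyNoetherian X'] [QuasiCompact π]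
    {G : X'.Modules} (hG : IsAffineLocalizing G) : IsAffineLocalizing ((pushforward π).obj G) := by
  refine isAffineLocalizing_of_restrict _ fun V hV => ?_
  haveI : IsNoetherian (↑(π ⁻¹ᵁ V) : Scheme.{u}) := isNoetherian_preimage π hV
  obtain ⟨e⟩ := nonempty_restrict_pushforward_iso π G V
  exact IsAffineLocalizing.of_iso e.symm
    (isAffineLocalizing_pushforward (π ∣_ V) (isAffineLocalizing_restrict (π ⁻¹ᵁ V).ι G hG))

/-- `π_* G` is affine-localizing for `π` quasi-compact and locally of finite type (e.g. proper) over a locally Noetherian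
base and `G` affine-localizing (`X'` is then locally Noetherian, Mathlib `LocallyOfFiniteType.isLocallyNoetherian`).
[cite: Hartshorne1977, II Prop. 5.8 (c) (p. 115)] -/
theorem isAffineLocalizing_pushforward_of_locallyOfFiniteType [IsLocallyNoetherian X] [QuasiCompact π]
    [LocallyOfFiniteType π] {G : X'.Modules} (hG : IsAffineLocalizing G) :
    IsAffineLocalizing ((pushforward π).obj G) :=
  haveI : IsLocallyNoetherian X' := LocallyOfFiniteType.isLocallyNoetherian π
  isAffineLocalizing_pushforward_of_quasiCompact π hG

/-- `π_* G` is affine-localizing for `π` quasi-compact and locally of finite type (e.g. proper) over a locally Noetherian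
base and `G` QUASI-COHERENT in Mathlib's sense (★ `IsAffineLocalizing.of_isQuasicoherent`).
[cite: Hartshorne1977, II Prop. 5.8 (c) (p. 115)] -/
theorem isAffineLocalizing_pushforward_of_isQuasicoherent [IsLocallyNoetherian X] [QuasiCompact π]
    [LocallyOfFiniteType π] (G : X'.Modules) [G.IsQuasicoherent] : IsAffineLocalizing ((pushforward π).obj G) :=
  isAffineLocalizing_pushforward_of_locallyOfFiniteType π (IsAffineLocalizing.of_isQuasicoherent G)

/-- **`π_* G` is affine-localizing for `G` FINITE LOCALLY FREE** and `π` quasi-compact, locally of finite type (e.g.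
proper) over a locally Noetherian base — the hypothesis `hN : IsAffineLocalizing (p_* G)` of ★
`Modules/PushforwardHasRankOfFibreVanishing`, `Modules/CompleteLinearSystemLocus`, `Modules/PushforwardBaseChangeCharts{,Top}`,
`…RestrictBase`, `…IsoOfFibreVanishingGeneralBase`, discharged over ANY locally Noetherian base (a finite locally free
module is a vector bundle, ★ `IsFiniteLocallyFree.isVectorBundle`, hence quasi-coherent).
[cite: Hartshorne1977, II Prop. 5.8 (c) (p. 115)] [cite: StacksProject, Tag 01LC] -/
theorem isAffineLocalizing_pushforward_of_isFiniteLocallyFree [IsLocallyNoetherian X] [QuasiCompact π]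
    [LocallyOfFiniteType π] {G : X'.Modules} (hL : IsFiniteLocallyFree G) :
    IsAffineLocalizing ((pushforward π).obj G) :=
  haveI := hL.isVectorBundle.1
  isAffineLocalizing_pushforward_of_isQuasicoherent π G

/-- **Direct images of coherent modules under proper morphisms are coherent** — EGA III Thm. 3.2.1 in degree `0` over a
LOCALLY Noetherian base, with no compactness hypothesis on the source ([StacksProject, Tag 02O5]: «Let `S` be a locally
Noetherian scheme. Let `f : X → S` be a proper morphism. Let `𝓕` be a coherent `𝒪_X`-module. Then `R^i f_* 𝓕` is a
coherent `𝒪_S`-module for all `i ≥ 0`», case `i = 0`; [GortzWedhorn2023] Thm. 23.17): affine-localizing by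
`isAffineLocalizing_pushforward_of_quasiCompact`, affine-locally of finite type by ★ `isAffineFiniteType_pushforward_of_isProper`
(the finiteness theorem over each affine open of the base).
[cite: StacksProject, Tag 02O5 (Cohomology of Schemes, Proposition 30.19.1, i = 0)] [cite: GortzWedhorn2023, Thm. 23.17 (p. 306)] -/
theorem Coh.pushforward_of_isProper [IsLocallyNoetherian X] [IsProper π] {G : X'.Modules} (hG : Coh G) :
    Coh ((pushforward π).obj G) :=
  ⟨isAffineLocalizing_pushforward_of_locallyOfFiniteType π hG.loc, isAffineFiniteType_pushforward_of_isProper π hG⟩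

end QuasiCompact

end Literature.AlgebraicGeometry.Morphisms

end
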